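import Summits.ResolutionOfSingularities.ResolutionOfSingularities.Theorems.EquisingularLiftEquisingularLiftNatPointStep
import Literature.AlgebraicGeometry.CossartPiltant200819.Thm21ProjectiveMorphisms2008
import HarnessLib

/-!
# [OURS · L1 W4.5(b) · EL♮] T-EXACT-SHADOW «a downstairs resolution by blow-ups in singular centres, each centre with an
# EXACT admissible lift, lifts to a horizontal E1 chain», any dimension — the engine
# (res-L1-w45b-lead-2's TARGET (6) 2026-08-27T07:06:48Z; the general conditional rung behind T-ISO-0 / (4) / (5))

Crux `EquisingularLiftNat` = stmt-ResolutionOfSingularities-20038 (route EquisingularLift), line `sections`; helper file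
`--supports … --as helper` by res-D-pv-037 (pool seat, TAKING 2026-08-27T07:19:43Z). HONEST FRAMING: OURS (cell res-hironaka,
slot W4.5(b)); NOT a statement of any manuscript; a CONDITIONAL rung (the exact-lift hypothesis `(MS)` is an explicit binder,
discharged nowhere in this file). AI-written, weaker than expert review. No `sorry`; standard axioms.

SETTING (that of `pointStep` p505032 / `oneStep_horizChainE1` p505461): a DVR `O`, an ambient `q : P → Spec O` (smooth, proper),
`Y ⊆ P` closed irreducible inside the special fibre, and a stage predicate `Ch` over `P` which implies `Split.Chain` and is closed
under HORIZONTAL E1 steps (regular centre, `O`-flat, off the generic point of `Y`, special-fibre points inside the current strict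
transform). DOWNSTAIRS everything is INTRINSIC: abstract schemes `Γ` and blow-ups `υ : Γ₂ → Γ` along ideal sheaves `D` supported in
the non-regular locus (`Literature…Resolution.IsSingularBlowupSequence`, Cossart–Jannsen–Saito's «sequence of blow-ups in singular
centres») and satisfying a PARAMETER predicate `Adm Γ D` (iso-invariant). The invariant carried along is an ISOMORPHISM
`Γ ≅ V(closure S')_red` between the downstairs scheme and the reduced strict transform of the upstairs stage `(X', σ', S')`.

* `exactShadowStep` — ONE STEP. Upstairs stage `(X', σ', S')` with `Ch`; `e : Γ ≅ V(closure S')_red`; a downstairs blow-up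
  `υ : Γ₂ → Γ` along `D` (support in the non-regular locus); an upstairs centre `C` (regular, `O`-flat, E1) whose TRACE IS EXACT,
  `C · 𝒪_Γ = D` (`C.comap (e.hom ≫ ι) = D`); a blow-up `τ : X'' → X'` along `C`. THEN `(X'', τ ≫ σ', closure τ⁻¹(S' ∖ V(C)))` has `Ch`
  and `Γ₂ ≅ V(closure ·)_red`. The off-generic clause of the step is DERIVED (the generic point of `V(closure S')_red` is regular);
  the reduced strict transform is a blow-up of `V(closure S')_red` along the trace (DL `exists_isBlowup_reducedStrictTransform`,
  p167331, Stacks 080E); `υ ≫ e.hom` is a blow-up along the same ideal (`IsBlowup.comp_iso`); blow-ups are unique (`IsBlowup.unique`).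
* `horizChainE1_of_exactShadow` — THE RUNG, from ANY stage: if `Γ ≅ V(closure S')_red` is resolved downstairs by finitely many blow-ups
  in `Adm`-admissible singular centres (inductive closure `(DOWN)`, ∃-form, no ambient) and `(MS)` every `Adm`-admissible singular
  centre of every later `Ch`-stage has an exact admissible lift, then some `Ch`-stage has REGULAR reduced strict transform
  (T-ISO-0's induction p505885 with `pointStep` replaced by `exactShadowStep`).
* `reaches_of_isSingularBlowupSequence` — the Literature inductive `IsSingularBlowupSequence π` (`π : Γ' → Γ`) implies the `(DOWN)`
  closure clause from `Γ` to `Γ'` with `Adm := ⊤`.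

What it does NOT cover (lead-2): non-exact devices (combs `Γ ∪ e`, `(M)`-multiples, E-β extra lines) — there the upstairs centre's
trace is not the downstairs centre. References: …NatPointStep.lean, …NatPointResolution.lean (T-ISO-0), …NatOneStep.lean (R0),
…ReducedStrictTransformBlowup.lean (DL); Literature/…/CossartPiltant200819/Thm21ProjectiveMorphisms2008.lean
(`IsSingularBlowupSequence`, `CossartJannsenSaito2020Sequence`); Liu 2002 §8.1, Stacks 080E/0806; L/w45b/CHAIN.md v7.2.
-/

set_option linter.dupNamespace false -- mandated namespace `Summit.<Summit>.<Problem>` of this single-conjunct summit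
set_option linter.overlappingInstances false -- signatures carry `[IsDomain O] [IsDiscreteValuationRing O]`

noncomputable section

open CategoryTheory CategoryTheory.Limits AlgebraicGeometry TopologicalSpace Topology
open Literature.AlgebraicGeometry.Resolution
open AlgebraicGeometry.Scheme.IdealSheafData
open Summit.ResolutionOfSingularities.ResolutionOfSingularities.Theses.EquisingularLift.Split
open Summit.ResolutionOfSingularities.ResolutionOfSingularities.Cruxes.EquisingularLift.StrataSplit

namespace Summit.ResolutionOfSingularities.ResolutionOfSingularities.Cruxes.EquisingularLiftNat.Sections

universe u

/-! ## Small lemmas -/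

/-- The non-regular locus is invariant under isomorphisms of schemes: if `D` is supported in the non-regular locus of `Γ`
and `e : Γ ≅ Γ'`, then `D.comap e.inv` is supported in the non-regular locus of `Γ'`. [folklore] -/
theorem support_comap_inv_subset_compl_regularLocus {Γ Γ' : Scheme.{u}} (e : Γ ≅ Γ') (D : Γ.IdealSheafData)
    (hD : (D.support : Set Γ) ⊆ (Scheme.regularLocus Γ)ᶜ) :
    ((D.comap e.inv).support : Set Γ') ⊆ (Scheme.regularLocus Γ')ᶜ := by
  intro z hz hreg
  rw [Scheme.IdealSheafData.support_comap] at hz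
  have hz' : e.inv z ∈ (D.support : Set Γ) := hz
  refine hD hz' ?_
  change IsRegularLocalRing (Γ.presheaf.stalk (e.inv z))
  have h := (isRegularLocalRing_stalk_iff_of_iso e.symm z).mpr hreg
  exact h

/-- **The Literature inductive `IsSingularBlowupSequence π` implies the impredicative closure clause**: every predicate of
schemes holding at the base and stable under blow-ups along ideal sheaves supported in the non-regular locus holds at the
source. [folklore] -/
theorem reaches_of_isSingularBlowupSequence {Γ' Γ : Scheme.{u}} {π : Γ' ⟶ Γ} (hπ : IsSingularBlowupSequence π)
    (R : Scheme.{u} → Prop) (h0 : R Γ)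
    (hs : ∀ (Γ₁ Γ₂ : Scheme.{u}) (D : Γ₁.IdealSheafData) (υ : Γ₂ ⟶ Γ₁), R Γ₁ →
      (D.support : Set Γ₁) ⊆ (Scheme.regularLocus Γ₁)ᶜ → IsBlowup υ D → R Γ₂) : R Γ' := by
  induction hπ with
  | id X => exact h0
  | comp hσ hD _ ih => exact hs _ _ _ _ (ih h0) hD hσ

/-! ## The step -/

/-- **ONE EXACT-SHADOW STEP** (see the module docstring): an upstairs `Ch`-stage `(X', σ', S')`, an isomorphism
`e : Γ ≅ V(closure S')_red`, a downstairs blow-up `υ : Γ₂ → Γ` along `D` supported in the non-regular locus, an admissible upstairs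
centre `C` (regular, `O`-flat, E1) with EXACT trace `C.comap (e.hom ≫ ι) = D`, and a blow-up `τ : X'' → X'` along `C` give the next
`Ch`-stage `(X'', τ ≫ σ', closure τ⁻¹(S' ∖ V(C)))` together with `Γ₂ ≅ V(closure ·)_red`. [folklore; Stacks 080E, 0806;
Liu 2002 Thm 8.1.19] -/
theorem exactShadowStep (O : Type) [CommRing O] [IsDomain O] [IsDiscreteValuationRing O]
    (P : Scheme.{0}) (q : P ⟶ Spec (.of O)) (Y : Closeds P)
    (Ch : ∀ X' : Scheme.{0}, (X' ⟶ P) → Set X' → Prop)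
    (hChain : ∀ (X' : Scheme.{0}) (σ : X' ⟶ P) (S : Set X'), Ch X' σ S → Chain P (Y : Set P) X' σ S)
    (hStep : ∀ (X' X'' : Scheme.{0}) (σ' : X' ⟶ P) (S' : Set X') (C : X'.IdealSheafData) (τ : X'' ⟶ X'),
      Ch X' σ' S' → IsBlowup τ C → Scheme.IsRegular C.subscheme → Flat (C.subschemeι ≫ σ' ≫ q) →
      σ' '' (C.support : Set X') ⊆ {x : P | ¬ IsGenericPoint x (Y : Set P)} →
      (C.support : Set X') ∩ (σ' ≫ q) ⁻¹' {IsLocalRing.closedPoint O} ⊆ S' →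
      Ch X'' (τ ≫ σ') (closure (τ ⁻¹' (S' \ (C.support : Set X')))))
    (hq : Smooth q) (hqp : IsProper q) (hYirr : IsIrreducible (Y : Set P))
    -- the upstairs stage
    (X' : Scheme.{0}) (σ' : X' ⟶ P) (S' : Set X') (hCh : Ch X' σ' S')
    -- the downstairs stage and step
    (Γ Γ₂ : Scheme.{0}) (e : Γ ≅ (vanishingIdeal (⟨closure S', isClosed_closure⟩ : Closeds X')).subscheme)
    (D : Γ.IdealSheafData) (hD : (D.support : Set Γ) ⊆ (Scheme.regularLocus Γ)ᶜ)
    (υ : Γ₂ ⟶ Γ) (hυ : IsBlowup υ D)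
    -- the exact admissible lift and its blow-up
    (C : X'.IdealSheafData) (hCreg : Scheme.IsRegular C.subscheme) (hCflat : Flat (C.subschemeι ≫ σ' ≫ q))
    (hE1 : (C.support : Set X') ∩ (σ' ≫ q) ⁻¹' {IsLocalRing.closedPoint O} ⊆ S')
    (htrace : C.comap (e.hom ≫ (vanishingIdeal (⟨closure S', isClosed_closure⟩ : Closeds X')).subschemeι) = D)
    (X'' : Scheme.{0}) (τ : X'' ⟶ X') (hτ : IsBlowup τ C) :
    Ch X'' (τ ≫ σ') (closure (τ ⁻¹' (S' \ (C.support : Set X')))) ∧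
      Nonempty (Γ₂ ≅ (vanishingIdeal (⟨closure (closure (τ ⁻¹' (S' \ (C.support : Set X')))), isClosed_closure⟩ :
        Closeds X'')).subscheme) := by
  classical
  have hch : Chain P (Y : Set P) X' σ' S' := hChain _ _ _ hCh
  -- ambient facts
  haveI := hq
  haveI := hqp
  have hPnoeth : IsLocallyNoetherian P := LocallyOfFiniteType.isLocallyNoetherian q
  have hPreg : Scheme.IsRegular P := fun y => (stub_goodAtOfSmooth O P q hq y).1
  obtain ⟨hnoeth', -, hσ'⟩ := chain_isRegular P (Y : Set P) X' σ' S' hch hPnoeth hPreg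
  haveI := hnoeth'
  haveI := hσ'
  -- `S'` is closed irreducible with generic point `ξ'` over the generic point `ξ` of `Y`
  obtain ⟨ξ, hξ⟩ : ∃ ξ : P, IsGenericPoint ξ (Y : Set P) := QuasiSober.sober hYirr Y.isClosed
  obtain ⟨ξ', hfib', hS'⟩ := Chain.fibre hch hξ
  have hS'cl : IsClosed S' := by rw [hS']; exact isClosed_closure
  have hclS' : closure S' = S' := hS'cl.closure_eq
  have hS'irr : IsIrreducible (closure S') := by
    rw [hS', closure_closure]; exact isIrreducible_singleton.closure
  have hgen' : IsGenericPoint ξ' (closure S') := by rw [isGenericPoint_def, hS', closure_closure]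
  have hrange' : Set.range (vanishingIdeal (⟨closure S', isClosed_closure⟩ : Closeds X')).subschemeι = closure S' := by
    rw [range_subschemeι, Scheme.IdealSheafData.coe_support_vanishingIdeal]; rfl
  -- the off-generic clause, DERIVED: `ξ'` is a regular point of `V(closure S')_red`, the trace `D` lives in the non-regular locus
  have hξ'C : ξ' ∉ (C.support : Set X') := by
    intro hξ'C
    have hmem : ξ' ∈ Set.range (vanishingIdeal (⟨closure S', isClosed_closure⟩ : Closeds X')).subschemeι := by
      rw [hrange', hclS', hS']; exact subset_closure rfl
    obtain ⟨z, hz⟩ := hmem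
    -- `w = e⁻¹ z ∈ V(D)`
    have hw : e.inv z ∈ (D.support : Set Γ) := by
      rw [← htrace, Scheme.IdealSheafData.support_comap]
      change (e.hom ≫ (vanishingIdeal (⟨closure S', isClosed_closure⟩ : Closeds X')).subschemeι) (e.inv z) ∈
        (C.support : Set X')
      rw [← Scheme.Hom.comp_apply, e.inv_hom_id_assoc, hz]
      exact hξ'C
    have hwreg : ¬ IsRegularLocalRing (Γ.presheaf.stalk (e.inv z)) := fun h => hD hw h
    have hzreg : ¬ IsRegularLocalRing
        ((vanishingIdeal (⟨closure S', isClosed_closure⟩ : Closeds X')).subscheme.presheaf.stalk z) := fun h =>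
      hwreg ((isRegularLocalRing_stalk_iff_of_iso e.symm z).mpr h)
    exact not_isGenericPoint_of_not_isRegularLocalRing (⟨closure S', isClosed_closure⟩ : Closeds X') hS'irr z hzreg
      (hz ▸ hgen')
  have hTY : σ' '' (C.support : Set X') ⊆ {y : P | ¬ IsGenericPoint y (Y : Set P)} := by
    rintro _ ⟨c, hc, rfl⟩ hgen
    have h1 : σ' c = ξ := hgen.eq hξ
    have h2 : c = ξ' := by
      have : c ∈ σ' ⁻¹' {ξ} := h1
      rw [hfib'] at this
      simpa using this
    exact hξ'C (h2 ▸ hc)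
  have hnotsub : ¬ closure S' ⊆ (C.support : Set X') := fun h =>
    hξ'C (h (by rw [hclS', hS']; exact subset_closure rfl))
  -- blow up upstairs
  haveI : IsProper τ := hτ.isProper
  have hnoeth'' : IsLocallyNoetherian X'' := LocallyOfFiniteType.isLocallyNoetherian τ
  haveI := hnoeth''
  have hCh'' : Ch X'' (τ ≫ σ') (closure (τ ⁻¹' (S' \ (C.support : Set X')))) :=
    hStep X' X'' σ' S' C τ hCh hτ hCreg hCflat hTY hE1
  -- the reduced strict transform is a blow-up of `V(closure S')_red` along the trace (DL, Stacks 080E)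
  obtain ⟨ρ₁, -, -, hρ₁⟩ :=
    exists_isBlowup_reducedStrictTransform X' X'' τ C hτ (closure S') isClosed_closure hS'irr hnotsub
  -- downstairs: `υ ≫ e.hom` is a blow-up of `V(closure S')_red` along the same trace
  have hυ' : IsBlowup (υ ≫ e.hom) (D.comap e.inv) := hυ.comp_iso e
  have hDe : D.comap e.inv = C.comap (vanishingIdeal (⟨closure S', isClosed_closure⟩ : Closeds X')).subschemeι := by
    rw [← htrace, ← Scheme.IdealSheafData.comap_comp, e.inv_hom_id_assoc]
  rw [hDe] at hυ'
  obtain ⟨e₂, -, -⟩ := hυ'.unique hρ₁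
  -- rewrite the strict-transform set into the form of the conclusion
  have hUp : (⟨closure (τ ⁻¹' (closure S' \ (C.support : Set X'))), isClosed_closure⟩ : Closeds X'') =
      ⟨closure (closure (τ ⁻¹' (S' \ (C.support : Set X')))), isClosed_closure⟩ := by
    apply Closeds.ext
    change closure _ = closure (closure _)
    rw [closure_closure, hclS']
  rw [hUp] at e₂
  exact ⟨hCh'', ⟨e₂⟩⟩

/-! ## The rung -/

/-- **T-EXACT-SHADOW, from any stage** (see the module docstring). Fixed: `O`, `q : P → Spec O` smooth proper, `Y` closed
irreducible, a stage predicate `Ch` implying `Split.Chain` and closed under horizontal E1 steps, and an iso-invariant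
admissibility predicate `Adm Γ D` on (scheme, ideal sheaf). HYPOTHESES: `(MS)` at every `Ch`-stage `(X₁, σ₁, S₁)` (locally
Noetherian, regular, proper over `Spec O`, `S₁` closed irreducible inside the special fibre) every ideal sheaf `D` of
`V(closure S₁)_red` supported in the non-regular locus with `Adm _ D` has an EXACT ADMISSIBLE LIFT `C` (regular, `O`-flat,
special-fibre points inside `S₁`, `C.comap ι = D`); a `Ch`-stage `(X', σ', S')` and `e : Γ ≅ V(closure S')_red`; `(DOWN)` `Γ` reaches a
REGULAR scheme by finitely many blow-ups along `Adm`-admissible ideal sheaves supported in non-regular loci (inductive closure).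
CONCLUSION: some `Ch`-stage has regular reduced strict transform. [folklore; Liu 2002 §8.1] -/
theorem horizChainE1_of_exactShadow (O : Type) [CommRing O] [IsDomain O] [IsDiscreteValuationRing O]
    (P : Scheme.{0}) (q : P ⟶ Spec (.of O)) (Y : Closeds P)
    (Ch : ∀ X' : Scheme.{0}, (X' ⟶ P) → Set X' → Prop)
    (hChain : ∀ (X' : Scheme.{0}) (σ : X' ⟶ P) (S : Set X'), Ch X' σ S → Chain P (Y : Set P) X' σ S)
    (hStep : ∀ (X' X'' : Scheme.{0}) (σ' : X' ⟶ P) (S' : Set X') (C : X'.IdealSheafData) (τ : X'' ⟶ X'),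
      Ch X' σ' S' → IsBlowup τ C → Scheme.IsRegular C.subscheme → Flat (C.subschemeι ≫ σ' ≫ q) →
      σ' '' (C.support : Set X') ⊆ {x : P | ¬ IsGenericPoint x (Y : Set P)} →
      (C.support : Set X') ∩ (σ' ≫ q) ⁻¹' {IsLocalRing.closedPoint O} ⊆ S' →
      Ch X'' (τ ≫ σ') (closure (τ ⁻¹' (S' \ (C.support : Set X')))))
    (hq : Smooth q) (hqp : IsProper q)
    (hY : (Y : Set P) ⊆ q ⁻¹' {IsLocalRing.closedPoint O}) (hYirr : IsIrreducible (Y : Set P))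
    -- the admissibility parameter
    (Adm : ∀ Γ : Scheme.{0}, Γ.IdealSheafData → Prop)
    (hAdm : ∀ (Γ Γ' : Scheme.{0}) (e : Γ ≅ Γ') (D : Γ.IdealSheafData), Adm Γ D → Adm Γ' (D.comap e.inv))
    -- (MS) exact admissible lifts exist
    (hMS : ∀ (X₁ : Scheme.{0}) (σ₁ : X₁ ⟶ P) (S₁ : Set X₁), Ch X₁ σ₁ S₁ → IsLocallyNoetherian X₁ →
      Scheme.IsRegular X₁ → IsProper (σ₁ ≫ q) → IsClosed S₁ → IsIrreducible S₁ →
      S₁ ⊆ (σ₁ ≫ q) ⁻¹' {IsLocalRing.closedPoint O} →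
      ∀ D : ((vanishingIdeal (⟨closure S₁, isClosed_closure⟩ : Closeds X₁)).subscheme).IdealSheafData,
        (D.support : Set ↥(vanishingIdeal (⟨closure S₁, isClosed_closure⟩ : Closeds X₁)).subscheme) ⊆
          (Scheme.regularLocus (vanishingIdeal (⟨closure S₁, isClosed_closure⟩ : Closeds X₁)).subscheme)ᶜ →
        Adm (vanishingIdeal (⟨closure S₁, isClosed_closure⟩ : Closeds X₁)).subscheme D →
        ∃ C : X₁.IdealSheafData, Scheme.IsRegular C.subscheme ∧ Flat (C.subschemeι ≫ σ₁ ≫ q) ∧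
          (C.support : Set X₁) ∩ (σ₁ ≫ q) ⁻¹' {IsLocalRing.closedPoint O} ⊆ S₁ ∧
          C.comap (vanishingIdeal (⟨closure S₁, isClosed_closure⟩ : Closeds X₁)).subschemeι = D)
    -- the starting stage and the downstairs resolution
    (X' : Scheme.{0}) (σ' : X' ⟶ P) (S' : Set X') (hCh : Ch X' σ' S')
    (Γ : Scheme.{0}) (e : Γ ≅ (vanishingIdeal (⟨closure S', isClosed_closure⟩ : Closeds X')).subscheme)
    (hdown : ∃ Γs : Scheme.{0}, (∀ R : Scheme.{0} → Prop, R Γ →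
      (∀ (Γ₁ Γ₂ : Scheme.{0}) (D : Γ₁.IdealSheafData) (υ : Γ₂ ⟶ Γ₁), R Γ₁ →
        (D.support : Set Γ₁) ⊆ (Scheme.regularLocus Γ₁)ᶜ → Adm Γ₁ D → IsBlowup υ D → R Γ₂) → R Γs) ∧
      Scheme.IsRegular Γs) :
    ∃ (X'' : Scheme.{0}) (σ'' : X'' ⟶ P) (S'' : Set X''), Ch X'' σ'' S'' ∧
      Scheme.IsRegular (vanishingIdeal (⟨closure S'', isClosed_closure⟩ : Closeds X'')).subscheme := by
  classical
  -- ambient facts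
  have hPnoeth : IsLocallyNoetherian P := by
    haveI := hq
    exact LocallyOfFiniteType.isLocallyNoetherian q
  have hPreg : Scheme.IsRegular P := fun y => (stub_goodAtOfSmooth O P q hq y).1
  haveI := hqp
  -- THE DOWNSTAIRS INDUCTION PREDICATE: some upstairs `Ch`-stage has its reduced strict transform isomorphic to `Γ₁`
  let R : Scheme.{0} → Prop := fun Γ₁ => ∃ (X₁ : Scheme.{0}) (σ₁ : X₁ ⟶ P) (S₁ : Set X₁), Ch X₁ σ₁ S₁ ∧
    Nonempty (Γ₁ ≅ (vanishingIdeal (⟨closure S₁, isClosed_closure⟩ : Closeds X₁)).subscheme)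
  obtain ⟨Γs, hclos, hregs⟩ := hdown
  have hR : R Γs := by
    refine hclos R ⟨X', σ', S', hCh, ⟨e⟩⟩ ?_
    intro Γ₁ Γ₂ D υ hR₁ hD hAdmD hυ
    obtain ⟨X₁, σ₁, S₁, hCh₁, ⟨e₁⟩⟩ := hR₁
    have hch₁ : Chain P (Y : Set P) X₁ σ₁ S₁ := hChain _ _ _ hCh₁
    obtain ⟨hnoeth₁, hreg₁, hσ₁⟩ := chain_isRegular P (Y : Set P) X₁ σ₁ S₁ hch₁ hPnoeth hPreg
    haveI := hnoeth₁
    haveI := hσ₁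
    have hprop₁ : IsProper (σ₁ ≫ q) := inferInstance
    -- `S₁` is closed irreducible inside the special fibre
    obtain ⟨ξ, hξ⟩ : ∃ ξ : P, IsGenericPoint ξ (Y : Set P) := QuasiSober.sober hYirr Y.isClosed
    obtain ⟨ξ₁, -, hS₁⟩ := Chain.fibre hch₁ hξ
    have hS₁cl : IsClosed S₁ := by rw [hS₁]; exact isClosed_closure
    have hS₁irr : IsIrreducible S₁ := by rw [hS₁]; exact isIrreducible_singleton.closure
    have hS₁sub : S₁ ⊆ (σ₁ ≫ q) ⁻¹' {IsLocalRing.closedPoint O} := fun x hx =>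
      closure_subset_preimage_of_chain q hYirr Y.isClosed hY hch₁ (subset_closure hx)
    -- transport the centre to `V(closure S₁)_red` and lift it exactly
    have hD' := support_comap_inv_subset_compl_regularLocus e₁ D hD
    obtain ⟨C, hCreg, hCflat, hE1, htr⟩ := hMS X₁ σ₁ S₁ hCh₁ hnoeth₁ hreg₁ hprop₁ hS₁cl hS₁irr hS₁sub
      (D.comap e₁.inv) hD' (hAdm Γ₁ _ e₁ D hAdmD)
    have htrace : C.comap (e₁.hom ≫ (vanishingIdeal (⟨closure S₁, isClosed_closure⟩ : Closeds X₁)).subschemeι) = D := by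
      rw [Scheme.IdealSheafData.comap_comp, htr, ← Scheme.IdealSheafData.comap_comp, e₁.hom_inv_id,
        Scheme.IdealSheafData.comap_id]
    obtain ⟨X₂, τ, hτ⟩ := exists_isBlowup X₁ C
    obtain ⟨hCh₂, he₂⟩ := exactShadowStep O P q Y Ch hChain hStep hq hqp hYirr X₁ σ₁ S₁ hCh₁ Γ₁ Γ₂ e₁ D hD υ hυ
      C hCreg hCflat hE1 htrace X₂ τ hτ
    exact ⟨X₂, τ ≫ σ₁, _, hCh₂, he₂⟩
  -- THE END: transport the downstairs regularity through the isomorphism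
  obtain ⟨X₁, σ₁, S₁, hCh₁, ⟨e₁⟩⟩ := hR
  exact ⟨X₁, σ₁, S₁, hCh₁, hregs.of_iso e₁.hom⟩

end Summit.ResolutionOfSingularities.ResolutionOfSingularities.Cruxes.EquisingularLiftNat.Sections

end
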